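import Literature.MathematicalPhysics.QuantumLattice.GrassmannGaussianExpectation
import Literature.Probability.LatticeModels.UrsellInversion
import HarnessLib

/-!
# Truncated expectations on the Grassmann algebra and clustering of independent blocks

Trunk **QLatticeAQFT**; joins the Gaussian Grassmann integration layer
(`GrassmannGaussianExpectation.lean`, `gaussOn`) with the Möbius inversion over set partitions
(`Literature/Probability/LatticeModels/UrsellInversion.lean`, `ursellOf`).  Truncated expectations
`𝓔ᵀ(X₁, …, X_p)` (Mastropietro 2008, §2.3, (2.32)–(2.38); Benfatto–Giuliani–Mastropietro 2006,
(2.13)–(2.16)) are the cumulants of the simple expectations; for pairwise commuting (e.g. even)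
elements of the Grassmann algebra they are the Ursell function of the moments
`P ↦ E(∏_{i∈P} yᵢ)`.  This file defines them for an arbitrary linear "expectation" `E` and proves
the structural facts used in multiscale analysis: the cluster decomposition and the **vanishing of
truncated expectations between independent fermion blocks** (the product measure
`P(dψ^{(+1)}) P(dψ^{(≤0)})` of BGM (2.11)).

## Main results

* `scalarPart R` (a `def`: the coefficient of `θ_∅ = 1`), `scalarPart_algebraMap`, `scalarPart_one`;
* `truncatedOf R E y hy` (a `def`: `ursellOf` of `P ↦ scalarPart (E (∏_{i∈P} yᵢ))` for pairwise
  commuting `y`), `sum_setPartitions_prod_truncatedOf` (cluster decomposition),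
  `truncatedOf_singleton`;
* `truncatedOf_eq_zero_of_factorises` — if `E` (with `scalarPart (E 1) = 1`) factorises on two
  subalgebras `S₁, S₂`, the truncated expectation of variables from `S₁` and `S₂` vanishes as soon
  as both occur (from `ursellOf_eq_zero_of_factorises` and `Finset.noncommProd_union_of_disjoint`);
* `scalarPart_gaussOn_gaussOn_mul` — **independent Gaussian blocks factorise**:
  `𝓔₁₂(g₁g₂) 𝓔₁₂(1) = 𝓔₁₂(g₁) 𝓔₁₂(g₂)` for the iterated integration `𝓔₁₂ = 𝓔^{ψ₁}_{A₁} ∘ 𝓔^{ψ₂}_{A₂}`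
  of disjoint blocks and `gᵢ` in the algebra of the `ψᵢ`-fields;
* `truncatedOf_gaussOn_gaussOn_eq_zero` — hence the truncated expectations of the normalised
  product measure vanish between the two blocks.

## Sources

V. Mastropietro, *Non-Perturbative Renormalization* (2008), §2.3–2.4, (2.32)–(2.40), PDF
pp. 34–35 of the held copy; bib key `Mastropietro2008`.  G. Benfatto, A. Giuliani, V. Mastropietro,
Ann. Henri Poincaré 7 (2006), §2.2, (2.11)–(2.16) (arXiv p. 6 of the held copy); bib key
`BenfattoGiulianiMastropietro2006`.  D. Ruelle, *Statistical Mechanics* (1969), §4.4.1–4.4.3 (PDF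
pp. 77–78 of the held copy); bib key `Ruelle1969`.
-/

noncomputable section

/-! ## Truncated expectations -/

namespace Literature.MathematicalPhysics.QuantumLattice

section QLatticeAQFT

open ExteriorAlgebra GrassmannAlgebra Literature.Probability.LatticeModels

variable (R : Type*) [CommRing R] {J : Type*} [LinearOrder J] [Fintype J]

/-- The **scalar part** of an element of the Grassmann algebra: its coefficient on the empty
monomial `θ_∅ = 1`. [folklore] -/
def scalarPart : GrassmannAlgebra R J →ₗ[R] R := (grassmannBasis R J).coord ∅

/-- The scalar part of a scalar. [folklore] -/
@[simp] theorem scalarPart_algebraMap (r : R) : scalarPart R (algebraMap R (GrassmannAlgebra R J) r) = r := by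
  rw [scalarPart, Algebra.algebraMap_eq_smul_one, ← grassmannBasis_empty R (ι := J), map_smul,
    Module.Basis.coord_apply, Module.Basis.repr_self, Finsupp.single_eq_same, smul_eq_mul, mul_one]

/-- The scalar part of `1` is `1`. [folklore] -/
@[simp] theorem scalarPart_one : scalarPart R (1 : GrassmannAlgebra R J) = 1 := by
  rw [← map_one (algebraMap R (GrassmannAlgebra R J)), scalarPart_algebraMap]

variable {α : Type*} [DecidableEq α]

/-- **Truncated expectations** `𝓔ᵀ(y_{i₁}, …, y_{i_k})` (all multiplicities one) of a family of
pairwise commuting elements `y` with respect to a linear "expectation" `E` on the Grassmann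
algebra: the Ursell function (`ursellOf`, Möbius inversion over set partitions) of the moments
`P ↦ scalar part of E(∏_{i ∈ P} yᵢ)` (Mastropietro 2008, (2.32) with all `nᵢ = 1`, and (2.37);
Benfatto–Giuliani–Mastropietro 2006, (2.14)).  For `E` a normalised Gaussian Grassmann
integration and the `yᵢ` even monomials in the fields this is the `𝓔ᵀ` of loc. cit. [folklore] -/
def truncatedOf (E : GrassmannAlgebra R J →ₗ[R] GrassmannAlgebra R J) (y : α → GrassmannAlgebra R J)
    (hy : Pairwise fun i j => Commute (y i) (y j)) : Finset α → R :=
  ursellOf fun P => scalarPart R (E (P.noncommProd y fun _ _ _ _ h => hy h))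

/-- **Cluster decomposition of simple into truncated expectations** (Mastropietro 2008, (2.36)–(2.38);
Ruelle 1969, (4.7)): `E(∏_{i∈V} yᵢ) = Σ_{π ∈ setPartitions V} ∏_{P∈π} 𝓔ᵀ(y_P)` (scalar parts),
`V ≠ ∅`. [cite: Mastropietro2008, Ch. 2 (2.38)] -/
theorem sum_setPartitions_prod_truncatedOf (E : GrassmannAlgebra R J →ₗ[R] GrassmannAlgebra R J)
    (y : α → GrassmannAlgebra R J) (hy : Pairwise fun i j => Commute (y i) (y j)) {V : Finset α}
    (hV : V.Nonempty) :
    ∑ π ∈ setPartitions V, ∏ P ∈ π, truncatedOf R E y hy P =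
      scalarPart R (E (V.noncommProd y fun _ _ _ _ h => hy h)) :=
  sum_setPartitions_prod_ursellOf _ hV

/-- `𝓔ᵀ(yₐ) = E(yₐ)` (Mastropietro (2.34): `𝓔ᵀ(X;1) = 𝓔(X)`). [folklore] -/
theorem truncatedOf_singleton (E : GrassmannAlgebra R J →ₗ[R] GrassmannAlgebra R J)
    (y : α → GrassmannAlgebra R J) (hy : Pairwise fun i j => Commute (y i) (y j)) (a : α) :
    truncatedOf R E y hy {a} = scalarPart R (E (y a)) := by
  rw [truncatedOf, ursellOf_singleton, Finset.noncommProd_singleton]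

/-- **Truncated expectations of independent groups vanish**: if the (normalised) expectation `E`
factorises on two subalgebras `S₁`, `S₂` and the variables of `A` lie in `S₁`, those of `B` in `S₂`,
then `𝓔ᵀ(y_V) = 0` for every `V ⊆ A ∪ B` meeting both — the variables of the two groups are not
"connected" (Mastropietro 2008, §2.3, (2.38): truncated expectations are sums over connected
graphs). [folklore] -/
theorem truncatedOf_eq_zero_of_factorises (E : GrassmannAlgebra R J →ₗ[R] GrassmannAlgebra R J)
    (y : α → GrassmannAlgebra R J) (hy : Pairwise fun i j => Commute (y i) (y j))
    {S₁ S₂ : Subalgebra R (GrassmannAlgebra R J)} (hE1 : scalarPart R (E 1) = 1)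
    (hE : ∀ g₁ ∈ S₁, ∀ g₂ ∈ S₂, scalarPart R (E (g₁ * g₂)) = scalarPart R (E g₁) * scalarPart R (E g₂))
    {A B : Finset α} (hAB : Disjoint A B) (hyA : ∀ i ∈ A, y i ∈ S₁) (hyB : ∀ j ∈ B, y j ∈ S₂)
    {V : Finset α} (hV : V ⊆ A ∪ B) (hA : (V ∩ A).Nonempty) (hB : (V ∩ B).Nonempty) :
    truncatedOf R E y hy V = 0 := by
  refine ursellOf_eq_zero_of_factorises _ ?_ hAB ?_ hV hA hB
  · rw [Finset.noncommProd_empty, hE1]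
  · intro P hP Q hQ
    rw [Finset.noncommProd_union_of_disjoint (Finset.disjoint_of_subset_left hP
      (Finset.disjoint_of_subset_right hQ hAB))]
    exact hE _ (Submonoid.noncommProd_mem S₁.toSubmonoid P y _ fun i hi => hyA i (hP hi)) _
      (Submonoid.noncommProd_mem S₂.toSubmonoid Q y _ fun j hj => hyB j (hQ hj))

end QLatticeAQFT

/-! ### The product of two Gaussian Grassmann integrations -/

section ProductMeasure

open ExteriorAlgebra GrassmannAlgebra Literature.Probability.LatticeModels

variable (R : Type*) [CommRing R] [Algebra ℚ R] {ι : Type*} [LinearOrder ι] [Fintype ι]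
  {J : Type*} [LinearOrder J] [Fintype J]

/-- **Independent Gaussian blocks factorise**: for the product "measure"
`𝓔₁₂ = 𝓔^{ψ₁}_{A₁} ∘ 𝓔^{ψ₂}_{A₂}` of two disjoint fermion blocks and `g₁`, `g₂` in the algebras of
the `ψ₁`-, `ψ₂`-fields, `𝓔₁₂(g₁ g₂) · 𝓔₁₂(1) = 𝓔₁₂(g₁) · 𝓔₁₂(g₂)` (scalar parts), i.e. the
normalised product expectation factorises (BGM 2006, (2.11): independent fields
`ψ^{(+1)}`, `ψ^{(≤0)}`; Mastropietro 2008, (2.39)–(2.40)). [folklore] -/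
theorem scalarPart_gaussOn_gaussOn_mul (e₁ e₂ : ι ⊕ₗ ι ↪o J)
    (hd : Disjoint (Finset.univ.map e₁.toEmbedding) (Finset.univ.map e₂.toEmbedding))
    (A₁ A₂ : Matrix ι ι R) {g₁ g₂ : GrassmannAlgebra R J}
    (hg₁ : g₁ ∈ spectatorSubalgebra R (Finset.univ.map e₁.toEmbedding)ᶜ)
    (hg₂ : g₂ ∈ spectatorSubalgebra R (Finset.univ.map e₂.toEmbedding)ᶜ) :
    scalarPart R (gaussOn R e₁ A₁ (gaussOn R e₂ A₂ (g₁ * g₂))) * scalarPart R (gaussOn R e₁ A₁ (gaussOn R e₂ A₂ 1)) =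
      scalarPart R (gaussOn R e₁ A₁ (gaussOn R e₂ A₂ g₁)) * scalarPart R (gaussOn R e₁ A₁ (gaussOn R e₂ A₂ g₂)) := by
  set s₁ := Finset.univ.map e₁.toEmbedding with hs₁
  set s₂ := Finset.univ.map e₂.toEmbedding with hs₂
  have hmono : spectatorSubalgebra R s₁ᶜ ≤ spectatorSubalgebra R s₂ :=
    spectatorSubalgebra_mono R fun x hx => Finset.mem_compl.2 fun hx' => Finset.disjoint_left.1 hd hx' hx
  have hg₁' : g₁ ∈ spectatorSubalgebra R s₂ := hmono hg₁
  have hw₁ : ExteriorAlgebra.map (Function.ExtendByZero.linearMap R e₁) (grassmannExp (quadratic R A₁)) ∈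
      spectatorSubalgebra R s₁ᶜ :=
    map_extendByZero_mem_spectatorSubalgebra R e₁
      (fun k h => (Finset.mem_compl.1 h) (Finset.mem_map.2 ⟨k, Finset.mem_univ _, rfl⟩)) _
  have hw₂ : ExteriorAlgebra.map (Function.ExtendByZero.linearMap R e₂) (grassmannExp (quadratic R A₂)) ∈
      spectatorSubalgebra R s₂ᶜ :=
    map_extendByZero_mem_spectatorSubalgebra R e₂
      (fun k h => (Finset.mem_compl.1 h) (Finset.mem_map.2 ⟨k, Finset.mem_univ _, rfl⟩)) _
  obtain ⟨r₁, hr₁⟩ := exists_berezinOn_eq_algebraMap R (Subalgebra.mul_mem _ hw₁ hg₁)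
  obtain ⟨r₂, hr₂⟩ := exists_berezinOn_eq_algebraMap R (Subalgebra.mul_mem _ hw₂ hg₂)
  have h1 : gaussOn R e₁ A₁ g₁ = algebraMap R _ r₁ := hr₁
  have h2 : gaussOn R e₂ A₂ g₂ = algebraMap R _ r₂ := hr₂
  set c₁ : R := (-1 : R) ^ (Fintype.card ι * (Fintype.card ι - 1) / 2) * A₁.det with hc₁
  set c₂ : R := (-1 : R) ^ (Fintype.card ι * (Fintype.card ι - 1) / 2) * A₂.det with hc₂
  have hone₁ : gaussOn R e₁ A₁ 1 = algebraMap R _ c₁ := gaussOn_one R e₁ A₁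
  have hone₂ : gaussOn R e₂ A₂ 1 = algebraMap R _ c₂ := gaussOn_one R e₂ A₂
  -- the four iterated integrals
  have q1 : gaussOn R e₁ A₁ (gaussOn R e₂ A₂ (g₁ * g₂)) = r₂ • algebraMap R _ r₁ := by
    rw [gaussOn_spectator_mul R e₂ A₂ hg₁', h2, ← Algebra.commutes, ← Algebra.smul_def, map_smul, h1]
  have q2 : gaussOn R e₁ A₁ (gaussOn R e₂ A₂ 1) = c₂ • algebraMap R _ c₁ := by
    rw [hone₂, Algebra.algebraMap_eq_smul_one, map_smul, hone₁]
  have q3 : gaussOn R e₁ A₁ (gaussOn R e₂ A₂ g₁) = c₂ • algebraMap R _ r₁ := by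
    rw [← mul_one g₁, gaussOn_spectator_mul R e₂ A₂ hg₁', hone₂, ← Algebra.commutes, ← Algebra.smul_def,
      map_smul, h1]
  have q4 : gaussOn R e₁ A₁ (gaussOn R e₂ A₂ g₂) = r₂ • algebraMap R _ c₁ := by
    rw [h2, Algebra.algebraMap_eq_smul_one, map_smul, hone₁]
  rw [q1, q2, q3, q4]
  simp only [map_smul, scalarPart_algebraMap, smul_eq_mul]
  ring

/-- **Clustering of the truncated expectations of independent Gaussian blocks**: for the product
measure of two disjoint fermion blocks, normalised (`𝓔 = (ε det A₁ ε det A₂)⁻¹ 𝓔₁₂`, a linear map with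
`scalar part of 𝓔(1) = 1` satisfying the factorisation of `scalarPart_gaussOn_gaussOn_mul`), the
truncated expectations `𝓔ᵀ(y_V)` of pairwise commuting variables vanish as soon as `V` contains a
function of the `ψ₁`-fields and a function of the `ψ₂`-fields (BGM 2006, §2.2–2.3; Mastropietro
2008, (2.38)–(2.40)). [folklore] -/
theorem truncatedOf_gaussOn_gaussOn_eq_zero (e₁ e₂ : ι ⊕ₗ ι ↪o J)
    (hd : Disjoint (Finset.univ.map e₁.toEmbedding) (Finset.univ.map e₂.toEmbedding))
    (A₁ A₂ : Matrix ι ι R) (u : R)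
    (hu : u * ((-1 : R) ^ (Fintype.card ι * (Fintype.card ι - 1) / 2) * A₁.det *
      ((-1 : R) ^ (Fintype.card ι * (Fintype.card ι - 1) / 2) * A₂.det)) = 1)
    {α : Type*} [DecidableEq α] (y : α → GrassmannAlgebra R J) (hy : Pairwise fun i j => Commute (y i) (y j))
    {A B : Finset α} (hAB : Disjoint A B)
    (hyA : ∀ i ∈ A, y i ∈ spectatorSubalgebra R (Finset.univ.map e₁.toEmbedding)ᶜ)
    (hyB : ∀ j ∈ B, y j ∈ spectatorSubalgebra R (Finset.univ.map e₂.toEmbedding)ᶜ)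
    {V : Finset α} (hV : V ⊆ A ∪ B) (hA : (V ∩ A).Nonempty) (hB : (V ∩ B).Nonempty) :
    truncatedOf R (u • (gaussOn R e₁ A₁ ∘ₗ gaussOn R e₂ A₂)) y hy V = 0 := by
  have hq : gaussOn R e₁ A₁ (gaussOn R e₂ A₂ 1) =
      ((-1 : R) ^ (Fintype.card ι * (Fintype.card ι - 1) / 2) * A₂.det) •
        algebraMap R _ ((-1 : R) ^ (Fintype.card ι * (Fintype.card ι - 1) / 2) * A₁.det) := by
    rw [gaussOn_one, Algebra.algebraMap_eq_smul_one, map_smul, gaussOn_one]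
  have hone : scalarPart R ((u • (gaussOn R e₁ A₁ ∘ₗ gaussOn R e₂ A₂)) 1) = 1 := by
    rw [LinearMap.smul_apply, LinearMap.comp_apply, hq, map_smul, map_smul, scalarPart_algebraMap, smul_eq_mul,
      smul_eq_mul]
    linear_combination hu
  refine truncatedOf_eq_zero_of_factorises R _ y hy hone (fun g₁ hg₁ g₂ hg₂ => ?_) hAB hyA hyB hV hA hB
  have hf := scalarPart_gaussOn_gaussOn_mul R e₁ e₂ hd A₁ A₂ hg₁ hg₂
  have h1 : scalarPart R (gaussOn R e₁ A₁ (gaussOn R e₂ A₂ 1)) =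
      (-1 : R) ^ (Fintype.card ι * (Fintype.card ι - 1) / 2) * A₁.det *
        ((-1 : R) ^ (Fintype.card ι * (Fintype.card ι - 1) / 2) * A₂.det) := by
    rw [hq, map_smul, scalarPart_algebraMap, smul_eq_mul, mul_comm]
  simp only [LinearMap.smul_apply, LinearMap.comp_apply, map_smul, smul_eq_mul]
  rw [h1] at hf
  -- `u² · (E(g₁g₂) · c) = u² · (E g₁ · E g₂)` with `u c = 1`
  calc u * scalarPart R (gaussOn R e₁ A₁ (gaussOn R e₂ A₂ (g₁ * g₂)))
      = u * scalarPart R (gaussOn R e₁ A₁ (gaussOn R e₂ A₂ (g₁ * g₂))) * (u *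
          ((-1 : R) ^ (Fintype.card ι * (Fintype.card ι - 1) / 2) * A₁.det *
            ((-1 : R) ^ (Fintype.card ι * (Fintype.card ι - 1) / 2) * A₂.det))) := by rw [hu, mul_one]
    _ = u * u * (scalarPart R (gaussOn R e₁ A₁ (gaussOn R e₂ A₂ g₁)) *
          scalarPart R (gaussOn R e₁ A₁ (gaussOn R e₂ A₂ g₂))) := by rw [← hf]; ring
    _ = u * scalarPart R (gaussOn R e₁ A₁ (gaussOn R e₂ A₂ g₁)) *
          (u * scalarPart R (gaussOn R e₁ A₁ (gaussOn R e₂ A₂ g₂))) := by ring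

end ProductMeasure

end Literature.MathematicalPhysics.QuantumLattice
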